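import Summits.QuantumFields.YangMills.Theses.OnsetCalibration

/-!
# Route `OnsetCalibration`, crux K2 `SubOnsetCeilings` (stmt-QuantumFields-23313): normal form and logical geography

Kernel-checked bookkeeping about the crux AS TYPED (lead seat `ym-line-oc-p1`, generation 5), landed `--supports`
so that planners, refuters and a future closing prover can cite it instead of re-auditing the quantifiers by hand.

* `floor_anti`, `live_anti`, `subOnset_mono`, `ceilings_anti` — the both-floor condition is antitone in the level
  `ε`, hence «sub-onset at level `ε`» is monotone and the ceilings clause antitone in `ε`.
* `subOnsetCeilings_iff_live_imp_ceilings` — consequently the `∃ ε₀ > 0, ∀ ε ≤ ε₀` prefix of K2 is inert: for each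
  datum `(G, r, v, f, g, h, Λ₅)` K2 says exactly «if the datum is live at SOME positive level then the sub-onset
  `(C/R⁴)ⁿ` ceilings hold at SOME positive level».
* `subOnsetCeilings_of_ceilings` — the LIVE-free sufficient condition (ceilings at one positive level per datum).
* `subOnsetCeilings_of_momentBounds6_dominated` — ceilings at ANY unit map `a` carrying the plane-resolved collar
  output `MomentBounds6 G r a` of `DlrCollarTransfer` (the spine's E0′ node; routes `BalabanLadder`,
  `InfiniteVolumeContinuum`) that is dominated by the datum's both-floor onset (`a β ≤ κ·s` for every sub-onset
  resolution `s`, `β` large) give K2 with `ℓ₄' = ℓ₄/κ` (adapted from the lead's crux workfile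
  `Cruxes/SubOnsetCeilings/Geography.lean`, generation 0).  The domination hypothesis is a self-location statement
  about ARBITRARY live data and is NOT claimed; it is why K2 is not literally a corollary of the ladder's ceilings.

Nothing here proves K2 — an open problem (observable-level UV stability of 4-d SU(2) Wilson lattice gauge theory,
uniform in volume, out to the self-located sub-onset range; barrier `UVStabilityNonUniqueness`, E0′).  Rung R2a-IV
(`HypercubicOSDataFromInfiniteVolume`) stays CONDITIONAL on K1 `OnsetFloors` (the NT residual) ∧ K2; the Yang–Mills
mass gap is NOT proved by anything in this file or this route.
-/

set_option autoImplicit false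

noncomputable section

open scoped SchwartzMap
open MeasureTheory Filter Topology
open Literature.MathematicalPhysics.QuantumFieldTheory Literature.MathematicalPhysics.QuantumLattice
open Literature.MathematicalPhysics.AQFT Literature.Probability.LatticeModels
open Summit.QuantumFields.YangMills.Cruxes.OSLegsFromFemtoAndGap.DlrCollarTransfer

namespace Summit.QuantumFields.YangMills.Theorems.OnsetCalibration

section Datum

variable {G : Type} [Group G] [TopologicalSpace G] [IsTopologicalGroup G] [CompactSpace G]
  [MeasurableSpace G] [BorelSpace G] {r : LatticeRep G} {v f g h : 𝓢(EuclideanSpace ℝ (Fin 4), ℝ)} {Λ₅ : ℝ}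

/-- The both-floor condition at `(β, s)` — `ε ≤ Q2(θv,v)` and `ε ≤ |Q3(f,g,h)|` on every torus with `Λ₅ ≤ s·L` —
is antitone in the level: a floor at level `ε` is a floor at every level `ε' ≤ ε`. -/
theorem floor_anti {ε ε' β s : ℝ} (hle : ε' ≤ ε)
    (hfl : (∀ L : ℕ, Λ₅ ≤ s * L → ε ≤ Q2 G r β L s (thetaTest 4 v) v) ∧
      (∀ L : ℕ, Λ₅ ≤ s * L → ε ≤ |Q3 G r β L s f g h|)) :
    (∀ L : ℕ, Λ₅ ≤ s * L → ε' ≤ Q2 G r β L s (thetaTest 4 v) v) ∧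
      (∀ L : ℕ, Λ₅ ≤ s * L → ε' ≤ |Q3 G r β L s f g h|) :=
  ⟨fun L hL => hle.trans (hfl.1 L hL), fun L hL => hle.trans (hfl.2 L hL)⟩

/-- Liveness («for all large `β` SOME resolution `s ∈ (0,1]` carries both floors at level `ε`») is antitone in the
level `ε`. -/
theorem live_anti {ε ε' : ℝ} (hle : ε' ≤ ε)
    (hlive : ∃ β₅ : ℝ, ∀ β : ℝ, β₅ ≤ β → ∃ s : ℝ, 0 < s ∧ s ≤ 1 ∧
      (∀ L : ℕ, Λ₅ ≤ s * L → ε ≤ Q2 G r β L s (thetaTest 4 v) v) ∧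
      (∀ L : ℕ, Λ₅ ≤ s * L → ε ≤ |Q3 G r β L s f g h|)) :
    ∃ β₅ : ℝ, ∀ β : ℝ, β₅ ≤ β → ∃ s : ℝ, 0 < s ∧ s ≤ 1 ∧
      (∀ L : ℕ, Λ₅ ≤ s * L → ε' ≤ Q2 G r β L s (thetaTest 4 v) v) ∧
      (∀ L : ℕ, Λ₅ ≤ s * L → ε' ≤ |Q3 G r β L s f g h|) := by
  obtain ⟨β₅, hβ₅⟩ := hlive
  refine ⟨β₅, fun β hβ => ?_⟩
  obtain ⟨s, hs0, hs1, hfl⟩ := hβ₅ β hβ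
  exact ⟨s, hs0, hs1, floor_anti hle hfl⟩

/-- «Sub-onset at level `ε`» (no resolution `s' ∈ [2s, 1]` carries both floors at level `ε`) is monotone in the
level: fewer floors at a higher level. -/
theorem subOnset_mono {ε ε' β s : ℝ} (hle : ε ≤ ε')
    (hsub : ∀ s' : ℝ, 2 * s ≤ s' → s' ≤ 1 →
      ¬ ((∀ L : ℕ, Λ₅ ≤ s' * L → ε ≤ Q2 G r β L s' (thetaTest 4 v) v) ∧
         (∀ L : ℕ, Λ₅ ≤ s' * L → ε ≤ |Q3 G r β L s' f g h|))) :
    ∀ s' : ℝ, 2 * s ≤ s' → s' ≤ 1 →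
      ¬ ((∀ L : ℕ, Λ₅ ≤ s' * L → ε' ≤ Q2 G r β L s' (thetaTest 4 v) v) ∧
         (∀ L : ℕ, Λ₅ ≤ s' * L → ε' ≤ |Q3 G r β L s' f g h|)) :=
  fun s' h2 h1 hfl => hsub s' h2 h1 (floor_anti hle hfl)

/-- The ceilings clause of K2 at level `ε` (constants `C, ℓ₄, β₄`; `(C/R⁴)ⁿ` bounds on the centred plane-string
moments at every sub-onset resolution, collars `R·s ≤ ℓ₄`) is antitone in the level: the hypothesis «sub-onset at
level `ε'`» only gets stronger as `ε'` decreases, with the SAME constants. -/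
theorem ceilings_anti {ε ε' : ℝ} (hle : ε' ≤ ε)
    (hceil : ∃ (C ℓ₄ β₄ : ℝ), 0 < ℓ₄ ∧ 0 ≤ C ∧ ∀ β : ℝ, β₄ ≤ β → ∀ s : ℝ, 0 < s → s ≤ 1 →
      (∀ s' : ℝ, 2 * s ≤ s' → s' ≤ 1 →
        ¬ ((∀ L : ℕ, Λ₅ ≤ s' * L → ε ≤ Q2 G r β L s' (thetaTest 4 v) v) ∧
           (∀ L : ℕ, Λ₅ ≤ s' * L → ε ≤ |Q3 G r β L s' f g h|))) →
      ∀ (L n : ℕ) (q : Fin n → Fin 4 × Fin 4) (x : Fin n → (Fin 4 → ℤ)) (R : ℕ), (∀ i, (q i).1 < (q i).2) →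
        1 ≤ R → (R : ℝ) * s ≤ ℓ₄ → 4 * R + 8 ≤ L →
        (∀ i j : Fin n, i ≠ j → ∃ k : Fin 4,
          (2 * (R : ℤ) + 4) ≤ |((((x i k - x j k : ℤ) : ZMod (2 * L + 1))).valMinAbs : ℤ)|) →
        |torusE G r β L (fun U => ∏ i, (plane G r (q i) (x i) U - torusE G r β L (plane G r (q i) (x i))))| ≤
          (C / (R : ℝ) ^ 4) ^ n) :
    ∃ (C ℓ₄ β₄ : ℝ), 0 < ℓ₄ ∧ 0 ≤ C ∧ ∀ β : ℝ, β₄ ≤ β → ∀ s : ℝ, 0 < s → s ≤ 1 →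
      (∀ s' : ℝ, 2 * s ≤ s' → s' ≤ 1 →
        ¬ ((∀ L : ℕ, Λ₅ ≤ s' * L → ε' ≤ Q2 G r β L s' (thetaTest 4 v) v) ∧
           (∀ L : ℕ, Λ₅ ≤ s' * L → ε' ≤ |Q3 G r β L s' f g h|))) →
      ∀ (L n : ℕ) (q : Fin n → Fin 4 × Fin 4) (x : Fin n → (Fin 4 → ℤ)) (R : ℕ), (∀ i, (q i).1 < (q i).2) →
        1 ≤ R → (R : ℝ) * s ≤ ℓ₄ → 4 * R + 8 ≤ L →
        (∀ i j : Fin n, i ≠ j → ∃ k : Fin 4,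
          (2 * (R : ℤ) + 4) ≤ |((((x i k - x j k : ℤ) : ZMod (2 * L + 1))).valMinAbs : ℤ)|) →
        |torusE G r β L (fun U => ∏ i, (plane G r (q i) (x i) U - torusE G r β L (plane G r (q i) (x i))))| ≤
          (C / (R : ℝ) ^ 4) ^ n := by
  obtain ⟨C, ℓ₄, β₄, hℓ₄, hC, hMB⟩ := hceil
  exact ⟨C, ℓ₄, β₄, hℓ₄, hC, fun β hβ s hs0 hs1 hsub => hMB β hβ s hs0 hs1 (subOnset_mono hle hsub)⟩

end Datum

/-- **Normal form of K2 (the `ε₀`-prefix is inert).**  `SubOnsetCeilings` holds iff for every SU(2)-class `G`,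
every lattice representation `r` and every floor datum `(v, f, g, h, Λ₅)`: IF the datum is live at some level
`ε > 0` (for all large `β` some resolution in `(0,1]` carries both floors) THEN at some level `ε > 0` the sub-onset
`(C/R⁴)ⁿ` ceilings hold.  (`→`: take `min ε₀ ε`; `←`: put `ε₀ :=` the ceilings level and use `ceilings_anti`,
or any `ε₀` when the datum is never live.) -/
theorem subOnsetCeilings_iff_live_imp_ceilings :
    Summit.QuantumFields.YangMills.Theses.OnsetCalibration.SubOnsetCeilings ↔
    ∀ (G : Type) [Group G] [TopologicalSpace G] [IsTopologicalGroup G] [CompactSpace G],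
      IsCompactSimpleLieGroup G → Nonempty (G ≃ₜ* Matrix.specialUnitaryGroup (Fin 2) ℂ) →
      letI : MeasurableSpace G := borel G
      haveI : BorelSpace G := ⟨rfl⟩
      ∀ (r : LatticeRep G) (v f g h : 𝓢(EuclideanSpace ℝ (Fin 4), ℝ)) (Λ₅ : ℝ),
        (∃ ε : ℝ, 0 < ε ∧ ∃ β₅ : ℝ, ∀ β : ℝ, β₅ ≤ β → ∃ s : ℝ, 0 < s ∧ s ≤ 1 ∧
            (∀ L : ℕ, Λ₅ ≤ s * L → ε ≤ Q2 G r β L s (thetaTest 4 v) v) ∧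
            (∀ L : ℕ, Λ₅ ≤ s * L → ε ≤ |Q3 G r β L s f g h|)) →
        ∃ ε : ℝ, 0 < ε ∧ ∃ (C ℓ₄ β₄ : ℝ), 0 < ℓ₄ ∧ 0 ≤ C ∧ ∀ β : ℝ, β₄ ≤ β → ∀ s : ℝ, 0 < s → s ≤ 1 →
          (∀ s' : ℝ, 2 * s ≤ s' → s' ≤ 1 →
            ¬ ((∀ L : ℕ, Λ₅ ≤ s' * L → ε ≤ Q2 G r β L s' (thetaTest 4 v) v) ∧
               (∀ L : ℕ, Λ₅ ≤ s' * L → ε ≤ |Q3 G r β L s' f g h|))) →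
          ∀ (L n : ℕ) (q : Fin n → Fin 4 × Fin 4) (x : Fin n → (Fin 4 → ℤ)) (R : ℕ), (∀ i, (q i).1 < (q i).2) →
            1 ≤ R → (R : ℝ) * s ≤ ℓ₄ → 4 * R + 8 ≤ L →
            (∀ i j : Fin n, i ≠ j → ∃ k : Fin 4,
              (2 * (R : ℤ) + 4) ≤ |((((x i k - x j k : ℤ) : ZMod (2 * L + 1))).valMinAbs : ℤ)|) →
            |torusE G r β L (fun U => ∏ i, (plane G r (q i) (x i) U - torusE G r β L (plane G r (q i) (x i))))| ≤
              (C / (R : ℝ) ^ 4) ^ n := by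
  unfold Summit.QuantumFields.YangMills.Theses.OnsetCalibration.SubOnsetCeilings
  constructor
  · intro hK2 G _ _ _ _ hG hcl
    letI : MeasurableSpace G := borel G
    haveI : BorelSpace G := ⟨rfl⟩
    intro r v f g h Λ₅ hlive
    obtain ⟨ε₁, hε₁, hlive₁⟩ := hlive
    obtain ⟨ε₀, hε₀, hK⟩ := hK2 G hG hcl r v f g h Λ₅
    refine ⟨min ε₀ ε₁, lt_min hε₀ hε₁, ?_⟩
    exact hK (min ε₀ ε₁) (lt_min hε₀ hε₁) (min_le_left _ _) (live_anti (min_le_right _ _) hlive₁)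
  · intro hNF G _ _ _ _ hG hcl
    letI : MeasurableSpace G := borel G
    haveI : BorelSpace G := ⟨rfl⟩
    intro r v f g h Λ₅
    by_cases hlive : ∃ ε : ℝ, 0 < ε ∧ ∃ β₅ : ℝ, ∀ β : ℝ, β₅ ≤ β → ∃ s : ℝ, 0 < s ∧ s ≤ 1 ∧
        (∀ L : ℕ, Λ₅ ≤ s * L → ε ≤ Q2 G r β L s (thetaTest 4 v) v) ∧
        (∀ L : ℕ, Λ₅ ≤ s * L → ε ≤ |Q3 G r β L s f g h|)
    · obtain ⟨ε, hε, hceil⟩ := hNF G hG hcl r v f g h Λ₅ hlive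
      exact ⟨ε, hε, fun ε' _ hε'le _ => ceilings_anti hε'le hceil⟩
    · refine ⟨1, one_pos, fun ε hε _ hl => ?_⟩
      exact absurd ⟨ε, hε, hl⟩ hlive

/-- **LIVE-free sufficient condition for K2.**  If for every datum the sub-onset `(C/R⁴)ⁿ` ceilings hold at SOME
positive level `ε` (no liveness hypothesis used), then `SubOnsetCeilings`. -/
theorem subOnsetCeilings_of_ceilings
    (hceil : ∀ (G : Type) [Group G] [TopologicalSpace G] [IsTopologicalGroup G] [CompactSpace G],
      IsCompactSimpleLieGroup G → Nonempty (G ≃ₜ* Matrix.specialUnitaryGroup (Fin 2) ℂ) →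
      letI : MeasurableSpace G := borel G
      haveI : BorelSpace G := ⟨rfl⟩
      ∀ (r : LatticeRep G) (v f g h : 𝓢(EuclideanSpace ℝ (Fin 4), ℝ)) (Λ₅ : ℝ),
        ∃ ε : ℝ, 0 < ε ∧ ∃ (C ℓ₄ β₄ : ℝ), 0 < ℓ₄ ∧ 0 ≤ C ∧ ∀ β : ℝ, β₄ ≤ β → ∀ s : ℝ, 0 < s → s ≤ 1 →
          (∀ s' : ℝ, 2 * s ≤ s' → s' ≤ 1 →
            ¬ ((∀ L : ℕ, Λ₅ ≤ s' * L → ε ≤ Q2 G r β L s' (thetaTest 4 v) v) ∧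
               (∀ L : ℕ, Λ₅ ≤ s' * L → ε ≤ |Q3 G r β L s' f g h|))) →
          ∀ (L n : ℕ) (q : Fin n → Fin 4 × Fin 4) (x : Fin n → (Fin 4 → ℤ)) (R : ℕ), (∀ i, (q i).1 < (q i).2) →
            1 ≤ R → (R : ℝ) * s ≤ ℓ₄ → 4 * R + 8 ≤ L →
            (∀ i j : Fin n, i ≠ j → ∃ k : Fin 4,
              (2 * (R : ℤ) + 4) ≤ |((((x i k - x j k : ℤ) : ZMod (2 * L + 1))).valMinAbs : ℤ)|) →
            |torusE G r β L (fun U => ∏ i, (plane G r (q i) (x i) U - torusE G r β L (plane G r (q i) (x i))))| ≤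
              (C / (R : ℝ) ^ 4) ^ n) :
    Summit.QuantumFields.YangMills.Theses.OnsetCalibration.SubOnsetCeilings := by
  refine subOnsetCeilings_iff_live_imp_ceilings.mpr ?_
  intro G _ _ _ _ hG hcl
  letI : MeasurableSpace G := borel G
  haveI : BorelSpace G := ⟨rfl⟩
  intro r v f g h Λ₅ _
  exact hceil G hG hcl r v f g h Λ₅

/-- **Logical geography: ceilings at an onset-dominated unit map give K2.**  If for every datum and every live level
`ε` there is SOME unit map `a` carrying the plane-resolved collar output `MomentBounds6 G r a` (e.g. the spine's E0′
ceilings at Bałaban's unit) that is DOMINATED by the datum's both-floor onset (`a β ≤ κ·s` for every sub-onset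
resolution `s`, `β` large), then `SubOnsetCeilings` holds with `ℓ₄' = ℓ₄/κ` (`R·a(β) ≤ κ·R·s ≤ ℓ₄`).  The domination
hypothesis is a self-location statement about arbitrary live data and is NOT claimed anywhere; this only kernel-checks
the relation between K2 and the ladder's ceilings.
-- adapted from Cruxes/SubOnsetCeilings/Geography.lean (lead g0, prover-ym-line-oc-p1-g0-0) -/
theorem subOnsetCeilings_of_momentBounds6_dominated
    (hdom : ∀ (G : Type) [Group G] [TopologicalSpace G] [IsTopologicalGroup G] [CompactSpace G],
      IsCompactSimpleLieGroup G → Nonempty (G ≃ₜ* Matrix.specialUnitaryGroup (Fin 2) ℂ) →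
      letI : MeasurableSpace G := borel G
      haveI : BorelSpace G := ⟨rfl⟩
      ∀ (r : LatticeRep G) (v f g h : 𝓢(EuclideanSpace ℝ (Fin 4), ℝ)) (Λ₅ : ℝ),
        ∃ ε₀ : ℝ, 0 < ε₀ ∧ ∀ ε : ℝ, 0 < ε → ε ≤ ε₀ →
          (∃ β₅ : ℝ, ∀ β : ℝ, β₅ ≤ β → ∃ s : ℝ, 0 < s ∧ s ≤ 1 ∧
            (∀ L : ℕ, Λ₅ ≤ s * L → ε ≤ Q2 G r β L s (thetaTest 4 v) v) ∧
            (∀ L : ℕ, Λ₅ ≤ s * L → ε ≤ |Q3 G r β L s f g h|)) →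
          ∃ (a : ℝ → ℝ) (κ β₆ : ℝ), 0 < κ ∧ MomentBounds6 G r a ∧
            ∀ β : ℝ, β₆ ≤ β → ∀ s : ℝ, 0 < s → s ≤ 1 →
              (∀ s' : ℝ, 2 * s ≤ s' → s' ≤ 1 →
                ¬ ((∀ L : ℕ, Λ₅ ≤ s' * L → ε ≤ Q2 G r β L s' (thetaTest 4 v) v) ∧
                   (∀ L : ℕ, Λ₅ ≤ s' * L → ε ≤ |Q3 G r β L s' f g h|))) → a β ≤ κ * s) :
    Summit.QuantumFields.YangMills.Theses.OnsetCalibration.SubOnsetCeilings := by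
  unfold Summit.QuantumFields.YangMills.Theses.OnsetCalibration.SubOnsetCeilings
  intro G _ _ _ _ hG hcl
  letI : MeasurableSpace G := borel G
  haveI : BorelSpace G := ⟨rfl⟩
  intro r v f g h Λ₅
  obtain ⟨ε₀, hε₀, h'⟩ := hdom G hG hcl r v f g h Λ₅
  refine ⟨ε₀, hε₀, fun ε hε hεle hlive => ?_⟩
  obtain ⟨a, κ, β₆, hκ, ⟨C, β₄, ℓ₄, hℓ₄, hC, hMB⟩, hle⟩ := h' ε hε hεle hlive
  refine ⟨C, ℓ₄ / κ, max β₄ β₆, by positivity, hC, ?_⟩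
  intro β hβ s hs0 hs1 hsub L n q x R hq hR hRs hRL hsep
  have haβ : a β ≤ κ * s := hle β (le_of_max_le_right hβ) s hs0 hs1 hsub
  have hRa : (R : ℝ) * a β ≤ ℓ₄ :=
    calc (R : ℝ) * a β ≤ (R : ℝ) * (κ * s) := mul_le_mul_of_nonneg_left haβ (Nat.cast_nonneg _)
      _ = κ * ((R : ℝ) * s) := by ring
      _ ≤ κ * (ℓ₄ / κ) := by gcongr
      _ = ℓ₄ := by field_simp
  exact hMB β (le_of_max_le_left hβ) L n q x R hq hR hRa hRL hsep

end Summit.QuantumFields.YangMills.Theorems.OnsetCalibration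

end
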